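import Literature.Barriers.FinalStateConjecture.HairyKerrBifurcation
import Literature.Geometry.Lorentzian.EndChartIntegral
import Literature.Geometry.Lorentzian.EinsteinTensorNaturality
import HarnessLib

/-!
# Barrier catalogue `FinalStateConjecture`: `HairyKerrBifurcation` — naturality of the
# Einstein–Klein–Gordon system under local diffeomorphisms (transport layer, proved)
(`Literature/Barriers/FinalStateConjecture/`, D-0021, D-0014, D-0026; family `gr`; namespace
`Literature.Barriers.FinalStateConjecture`, declarations as dot-notation extensions of
`Literature.Geometry.Lorentzian.PseudoRiemannianMetric` like those of `HairyKerrBifurcation.lean`)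

`HairyKerrBifurcation.lean` vendors Theorem 1.1 of O. Chodosh, Y. Shlapentokh-Rothman,
*Time-periodic Einstein–Klein–Gordon bifurcations of Kerr*, Comm. Math. Phys. 356 (2017)
1155–1250 (arXiv:1510.08025), on the FIXED carrier `Kerr.exterior M a` (ingoing Kerr–Schild
chart of the prelude), "transported along the isometry `(𝓜, g_0) ≅ Kerr_{M,a}` of clause (4)";
its module docstring argues, but does not prove, that "the Einstein–Klein–Gordon equations, the
Killing property and the phase law … are diffeomorphism-invariant statements". The printed
solutions live on CSR's coordinate manifold `{(t, φ, ρ, z)}` (§3.1, p. 11) with the ansatz of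
§2.1–§2.2; any proof of `HairyKerrBifurcation` therefore ends with a transport step along a
diffeomorphism `Φ` onto `Kerr.exterior M a`. This file PROVES the Einstein–Klein–Gordon part of
that step in the general setting of the naturality files (`ConnectionNaturality`,
`CurvatureNaturality`, `DalembertianNaturality`, `EinsteinTensorNaturality`: a smooth
equidimensional immersion `Φ : N → M`, a smooth metric `g` on `M`, its pullback
`Φ^*g = g.comap …`); the Killing part is `IsKillingField.comap_mpullback`
(`EinsteinTensorNaturality.lean`). No named fact is introduced (D-0026).

* `reDifferential_comp`, `imDifferential_comp` — chain rule:
  `d(Re (Ψ ∘ Φ))_u = d(Re Ψ)_{Φ u} ∘ dΦ_u` (Mathlib `mfderiv_comp`);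
* `kgStressEnergy_comap_apply` — **the energy–momentum tensor is natural**:
  `𝕋(Φ^*g, Ψ ∘ Φ)_u (v, w) = 𝕋(g, Ψ)_{Φ u} (dΦ v, dΦ w)` (chain rule, naturality of the inverse
  metric `innerDual_comap_apply`, and `(Φ^*g)_u = g_{Φ u} ∘ (dΦ × dΦ)`);
* `IsEinsteinKleinGordon.comap` — **the Einstein–Klein–Gordon system is natural**: if `(g, Ψ)`
  solves `Ric − ½ g R = 𝕋(g, Ψ)`, `□_g Ψ = μ² Ψ` and `Ψ` is `C²`, then `(Φ^*g, Ψ ∘ Φ)` solves the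
  same system (`einsteinTensor_comap_apply`, `kgStressEnergy_comap_apply`, `dalembertian_comap`)
  — Wald's general covariance of the field equations, for this matter model.

## References

* O. Chodosh, Y. Shlapentokh-Rothman, *Time-periodic Einstein–Klein–Gordon bifurcations of
  Kerr*, Comm. Math. Phys. 356 (2017) 1155–1250 (arXiv:1510.08025), §1 (pp. 3–4: the system),
  §2.1–§2.2 (pp. 7–8) and §3.1 (p. 11: the coordinate manifold), Thm. 1.1 (4) (p. 4: "isometric
  to a sub-extremal Kerr exterior").
* B. O'Neill, *Semi-Riemannian geometry* (1983), Ch. 3, p. 60 and Prop. 3.59–Cor. 3.61,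
  pp. 90–91 (local isometries preserve every metric quantity).
* R. M. Wald, *General Relativity* (1984), §4.1 and Appendix C.1 (general covariance: if
  `(g, Ψ)` solves the field equations so does `(φ^*g, φ^*Ψ)`).
-/

noncomputable section

open Bundle Set Function Filter VectorField
open scoped Manifold ContDiff Topology

namespace Literature.Barriers.FinalStateConjecture

open Literature.Geometry.Lorentzian
open Literature.Geometry.Lorentzian.PseudoRiemannianMetric

variable {E : Type*} [NormedAddCommGroup E] [NormedSpace ℝ E] {H : Type*} [TopologicalSpace H]
  {I : ModelWithCorners ℝ E H} {M : Type*} [TopologicalSpace M] [ChartedSpace H M]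
  [IsManifold I ∞ M]
  {E' : Type*} [NormedAddCommGroup E'] [NormedSpace ℝ E'] {H' : Type*} [TopologicalSpace H']
  {I' : ModelWithCorners ℝ E' H'} {N : Type*} [TopologicalSpace N] [ChartedSpace H' N]
  [IsManifold I' ∞ N]

/-! ### Chain rule for the differentials of `Re Ψ`, `Im Ψ` -/

omit [IsManifold I ∞ M] [IsManifold I' ∞ N] in
/-- **Chain rule for `d(Re Ψ)`**: for `Φ` differentiable at `u` and `Re Ψ` differentiable at
`Φ u`, `d(Re (Ψ ∘ Φ))_u = d(Re Ψ)_{Φ u} ∘ dΦ_u` (Mathlib `mfderiv_comp`). This is the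
transformation law `∂_α Ψ ↦ (∂Φ^β/∂y^α) ∂_β Ψ` of the gradient entering CSR's `𝕋_{αβ}` (§1, p. 3).
[cite: ChodoshShlapentokhrothman2017, §1 (p. 3)] -/
theorem _root_.Literature.Geometry.Lorentzian.PseudoRiemannianMetric.reDifferential_comp
    {Φ : N → M} {Ψ : M → ℂ} {u : N}
    (hΨ : MDifferentiableAt I 𝓘(ℝ, ℝ) (fun y ↦ (Ψ y).re) (Φ u))
    (hΦu : MDifferentiableAt I' I Φ u) :
    reDifferential I' (Ψ ∘ Φ) u = reDifferential I Ψ (Φ u) ∘ₗ (mfderiv I' I Φ u).toLinearMap := by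
  unfold reDifferential
  have h : (fun y ↦ ((Ψ ∘ Φ) y).re) = (fun y ↦ (Ψ y).re) ∘ Φ := rfl
  rw [h, mfderiv_comp u hΨ hΦu]
  rfl

omit [IsManifold I ∞ M] [IsManifold I' ∞ N] in
/-- **Chain rule for `d(Im Ψ)`**: `d(Im (Ψ ∘ Φ))_u = d(Im Ψ)_{Φ u} ∘ dΦ_u`.
[cite: ChodoshShlapentokhrothman2017, §1 (p. 3)] -/
theorem _root_.Literature.Geometry.Lorentzian.PseudoRiemannianMetric.imDifferential_comp
    {Φ : N → M} {Ψ : M → ℂ} {u : N}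
    (hΨ : MDifferentiableAt I 𝓘(ℝ, ℝ) (fun y ↦ (Ψ y).im) (Φ u))
    (hΦu : MDifferentiableAt I' I Φ u) :
    imDifferential I' (Ψ ∘ Φ) u = imDifferential I Ψ (Φ u) ∘ₗ (mfderiv I' I Φ u).toLinearMap := by
  unfold imDifferential
  have h : (fun y ↦ ((Ψ ∘ Φ) y).im) = (fun y ↦ (Ψ y).im) ∘ Φ := rfl
  rw [h, mfderiv_comp u hΨ hΦu]
  rfl

omit [IsManifold I ∞ M] in
/-- The real part of a `C^k` complex field is `C^k` (composition with the real-linear `Re`).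
[folklore] -/
theorem _root_.Literature.Geometry.Lorentzian.PseudoRiemannianMetric.contMDiff_re_of_contMDiff
    {k : ℕ∞ω} {Ψ : M → ℂ} (hΨ : ContMDiff I 𝓘(ℝ, ℂ) k Ψ) :
    ContMDiff I 𝓘(ℝ, ℝ) k (fun y ↦ (Ψ y).re) :=
  Complex.reCLM.contDiff.comp_contMDiff hΨ

omit [IsManifold I ∞ M] in
/-- The imaginary part of a `C^k` complex field is `C^k`. [folklore] -/
theorem _root_.Literature.Geometry.Lorentzian.PseudoRiemannianMetric.contMDiff_im_of_contMDiff
    {k : ℕ∞ω} {Ψ : M → ℂ} (hΨ : ContMDiff I 𝓘(ℝ, ℂ) k Ψ) :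
    ContMDiff I 𝓘(ℝ, ℝ) k (fun y ↦ (Ψ y).im) :=
  Complex.imCLM.contDiff.comp_contMDiff hΨ

/-! ### Naturality of the energy–momentum tensor -/

variable [FiniteDimensional ℝ E] [FiniteDimensional ℝ E'] [CompleteSpace E] [CompleteSpace E']
  (g : PseudoRiemannianMetric I ∞ E (TangentSpace I : M → Type _))
  {Φ : N → M} (hpb : contMDiff_pullbackBilin I M I' N ∞) (hΦ : ContMDiff I' I (∞ + 1) Φ)
  (hΦ' : ∀ u, Function.Injective (mfderiv I' I Φ u))
  (hdim : Module.finrank ℝ E' = Module.finrank ℝ E)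

omit [CompleteSpace E] [CompleteSpace E'] in
/-- **Naturality of the energy–momentum tensor of a complex scalar field.** For `Ψ : M → ℂ` with
`Re Ψ`, `Im Ψ` differentiable at `Φ u`,
`𝕋(Φ^*g, Ψ ∘ Φ)_u (v, w) = 𝕋(g, Ψ)_{Φ u} (dΦ_u v, dΦ_u w)`: the gradient terms
`Re(∂_αΨ ∂_βΨ̄)` transform by the chain rule (`reDifferential_comp`, `imDifferential_comp`), the
scalar `g^{γδ} Re(∂_γΨ ∂_δΨ̄) + μ²|Ψ|²` is invariant (`innerDual_comap_apply`), and
`(Φ^*g)_u = g_{Φ u}(dΦ ·, dΦ ·)`. Chodosh–Shlapentokh-Rothman, CMP 356 (2017), §1 (p. 3: the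
display defining `𝕋_{αβ}`), with O'Neill 1983, Ch. 3, Prop. 3.59 and Wald 1984, Appendix C.1
(tensorial quantities built from `g` and `Ψ` are natural under diffeomorphisms).
[cite: ChodoshShlapentokhrothman2017, §1 (p. 3)] -/
theorem _root_.Literature.Geometry.Lorentzian.PseudoRiemannianMetric.kgStressEnergy_comap_apply
    (μsq : ℝ) {Ψ : M → ℂ} {u : N}
    (hre : MDifferentiableAt I 𝓘(ℝ, ℝ) (fun y ↦ (Ψ y).re) (Φ u))
    (him : MDifferentiableAt I 𝓘(ℝ, ℝ) (fun y ↦ (Ψ y).im) (Φ u)) (v w : TangentSpace I' u) :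
    (g.comap hpb Φ hΦ hΦ' hdim).kgStressEnergy μsq (Ψ ∘ Φ) u v w =
      g.kgStressEnergy μsq Ψ (Φ u) (mfderiv I' I Φ u v) (mfderiv I' I Φ u w) := by
  have h1 : (1 : ℕ∞ω) ≤ ∞ + 1 := le_add_self
  have hΦu : MDifferentiableAt I' I Φ u := ((hΦ.of_le h1) u).mdifferentiableAt one_ne_zero
  rw [kgStressEnergy_apply, kgStressEnergy_apply, reDifferential_comp hre hΦu,
    imDifferential_comp him hΦu, innerDual_comap_apply, innerDual_comap_apply, val_comap,
    pullbackBilin_apply]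
  simp only [LinearMap.comp_apply, ContinuousLinearMap.coe_coe, Function.comp_apply]

omit [CompleteSpace E] [CompleteSpace E'] in
/-- Bundled form of `kgStressEnergy_comap_apply`: `𝕋(Φ^*g, Ψ ∘ Φ)_u = 𝕋(g, Ψ)_{Φ u} ∘ (dΦ_u × dΦ_u)`
as bilinear forms on `T_u N`. [cite: ChodoshShlapentokhrothman2017, §1 (p. 3)] -/
theorem _root_.Literature.Geometry.Lorentzian.PseudoRiemannianMetric.kgStressEnergy_comap
    (μsq : ℝ) {Ψ : M → ℂ} {u : N}
    (hre : MDifferentiableAt I 𝓘(ℝ, ℝ) (fun y ↦ (Ψ y).re) (Φ u))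
    (him : MDifferentiableAt I 𝓘(ℝ, ℝ) (fun y ↦ (Ψ y).im) (Φ u)) :
    (g.comap hpb Φ hΦ hΦ' hdim).kgStressEnergy μsq (Ψ ∘ Φ) u =
      (g.kgStressEnergy μsq Ψ (Φ u)).comp (mfderiv I' I Φ u).toLinearMap
        (mfderiv I' I Φ u).toLinearMap := by
  refine LinearMap.ext fun v ↦ LinearMap.ext fun w ↦ ?_
  rw [g.kgStressEnergy_comap_apply hpb hΦ hΦ' hdim μsq hre him v w, LinearMap.BilinForm.comp_apply]
  rfl

/-! ### Naturality of the Einstein–Klein–Gordon system -/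

include hΦ' in
/-- **The Einstein–Klein–Gordon system is natural under local diffeomorphisms** (general
covariance for this matter model). If `(g, Ψ)` solves `Ric(g) − ½ g R(g) = 𝕋(g, Ψ)`,
`□_g Re Ψ = μ² Re Ψ`, `□_g Im Ψ = μ² Im Ψ` on `M` and `Ψ` is `C²`, then for every smooth
equidimensional immersion `Φ : N → M` the pair `(Φ^*g, Ψ ∘ Φ)` solves the same system on `N`:
the Einstein equation by `einsteinTensor_comap_apply` and `kgStressEnergy_comap_apply` (both
sides are the `dΦ_u`-pullbacks of the two sides at `Φ u`), the Klein–Gordon equations by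
`dalembertian_comap` (`□_{Φ^*g}(f ∘ Φ) = (□_g f) ∘ Φ`). This is the step "transporting
`(g_δ, Ψ_δ)` along the fixed identification of the open domain of outer communications with
`Kerr.exterior M a`" of the module docstring of `HairyKerrBifurcation.lean`, for solutions
constructed in any other chart (CSR §3.1: `𝓜 = {(t, φ, ρ, z)}`). Wald 1984, §4.1 and Appendix C.1;
O'Neill 1983, Ch. 3, Prop. 3.59; Chodosh–Shlapentokh-Rothman, CMP 356 (2017), §1 (pp. 3–4) and
§3.1 (p. 11). [cite: ChodoshShlapentokhrothman2017, §1 (pp. 3–4) and §3.1 (p. 11)] -/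
theorem _root_.Literature.Geometry.Lorentzian.PseudoRiemannianMetric.IsEinsteinKleinGordon.comap
    [g.HasLeviCivita] [(g.comap hpb Φ hΦ hΦ' hdim).HasLeviCivita] {μsq : ℝ} {Ψ : M → ℂ}
    (h : g.IsEinsteinKleinGordon μsq Ψ) (hΨ : ContMDiff I 𝓘(ℝ, ℂ) 2 Ψ) :
    (g.comap hpb Φ hΦ hΦ' hdim).IsEinsteinKleinGordon μsq (Ψ ∘ Φ) where
  einstein u := by
    have hre : CMDiffAt 2 (fun y ↦ (Ψ y).re) (Φ u) := contMDiff_re_of_contMDiff hΨ (Φ u)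
    have him : CMDiffAt 2 (fun y ↦ (Ψ y).im) (Φ u) := contMDiff_im_of_contMDiff hΨ (Φ u)
    refine LinearMap.ext fun v ↦ LinearMap.ext fun w ↦ ?_
    rw [g.einsteinTensor_comap_apply hpb hΦ hΦ' hdim u v w, h.einstein (Φ u),
      g.kgStressEnergy_comap_apply hpb hΦ hΦ' hdim μsq (hre.mdifferentiableAt two_ne_zero)
        (him.mdifferentiableAt two_ne_zero) v w]
  kleinGordon_re u := by
    have hre : CMDiffAt 2 (fun y ↦ (Ψ y).re) (Φ u) := contMDiff_re_of_contMDiff hΨ (Φ u)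
    have hcomp : (fun y ↦ ((Ψ ∘ Φ) y).re) = (fun y ↦ (Ψ y).re) ∘ Φ := rfl
    rw [hcomp, g.dalembertian_comap hpb hΦ hΦ' hdim hre, h.kleinGordon_re (Φ u)]
    rfl
  kleinGordon_im u := by
    have him : CMDiffAt 2 (fun y ↦ (Ψ y).im) (Φ u) := contMDiff_im_of_contMDiff hΨ (Φ u)
    have hcomp : (fun y ↦ ((Ψ ∘ Φ) y).im) = (fun y ↦ (Ψ y).im) ∘ Φ := rfl
    rw [hcomp, g.dalembertian_comap hpb hΦ hΦ' hdim him, h.kleinGordon_im (Φ u)]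
    rfl

/-! ### Transport of a hairy family onto the Kerr–Schild exterior -/

section Transport

variable [Kerr.Facts] [Kerr.SliceFacts] {M₀ a ε μ : ℝ}
  {F : Type*} [NormedAddCommGroup F] [NormedSpace ℝ F] [FiniteDimensional ℝ F] [CompleteSpace F]
  {HF : Type*} [TopologicalSpace HF] {J : ModelWithCorners ℝ F HF}
  {X : Type*} [TopologicalSpace X] [ChartedSpace HF X] [IsManifold J ∞ X]

/-- **The fixed Kerr–Schild exterior is a faithful carrier (the transport step, proved).** Let
`δ ↦ (g'_δ, Ψ'_δ)` be a family of smooth Lorentzian metrics and complex fields on ANY smooth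
`4`-manifold `X` (e.g. Chodosh–Shlapentokh-Rothman's coordinate manifold
`𝓜 = {(t, φ, ρ, z)}`, §3.1, p. 11, or its extension across the axis and the horizon, §13.1 and
§13.3) satisfying the clauses
of Thm. 1.1 there — Einstein–Klein–Gordon with mass `μ²`, two Killing fields `Xs, Xa`, the phase
law `Ψ'_δ ∘ T_s = e^{−iωs} Ψ'_δ` for a flow `T` on `X`, `Ψ'_δ ≠ 0` for `δ > 0`, `Ψ'_0 = 0`,
pointwise differentiability in `δ` at `0⁺` with `δ⁻¹Ψ'_δ → Ψ̂' ≠ 0` a time-periodic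
Klein–Gordon solution for `g'_0` — and let `Φ : Kerr.exterior M a → X` be a smooth surjective
local diffeomorphism (the identification of clause (4): "`(𝓜, g_0)` is isometric to a
sub-extremal Kerr exterior") which (i) pulls `g'_0` back to the prelude's Kerr metric
`Kerr.smoothMetric M a r₊`, (ii) intertwines the stationary flow `Kerr.timeTranslate` with `T`,
and (iii) pulls `Xs, Xa` back to `∂_{t*} = Kerr.stationaryField`, `∂_{φ*} = Kerr.axialField`.
Then the transported family `(Φ^* g'_δ, Ψ'_δ ∘ Φ)` is a hairy Kerr family in the vendored sense
`IsHairyKerrFamily`. Every clause is carried by a naturality statement: the Einstein–Klein–Gordon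
system by `IsEinsteinKleinGordon.comap`, the Killing fields by `IsKillingField.comap_mpullback`,
the Klein–Gordon equation of `Ψ̂' ∘ Φ` on Kerr by `dalembertian_comap` and (i), the phase law by
(ii); smoothness, non-vanishing (surjectivity of `Φ`) and the pointwise `δ`-derivatives are read
through `Φ`. The Levi-Civita hypotheses are discharged by `PseudoRiemannianMetric.hasLeviCivita`.
This is the paragraph "Why the fixed Kerr–Schild exterior is a faithful carrier (argued here,
not proved)" of the module docstring of `HairyKerrBifurcation.lean`, now proved: it reduces
`HairyKerrBifurcation` to Thm. 1.1 on the authors' own manifold plus the explicit coordinate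
change `Φ` (Boyer–Lindquist/Weyl–Papapetrou to ingoing Kerr–Schild, `t* = t + f(r̃)`,
`φ* = φ + h(r̃)`) with properties (i)–(iii). Chodosh–Shlapentokh-Rothman, CMP 356 (2017),
Thm. 1.1 (p. 4), §2.1–§2.2 (pp. 7–8), §3.1 (p. 11), §13.1 (p. 54), §13.3 (p. 57); O'Neill
1983, Ch. 3,
Prop. 3.59 and Ch. 9, Prop. 9.25; Wald 1984, Appendix C.1.
[cite: ChodoshShlapentokhrothman2017, Thm. 1.1 (4) and §3.1 (p. 11)] -/
theorem IsHairyKerrFamily.of_comap (g' : ℝ → LorentzianMetric J ∞ X) (Ψ' : ℝ → X → ℂ)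
    {Φ : Kerr.exterior M₀ a → X}
    (hpb : contMDiff_pullbackBilin J X 𝓘(ℝ, E4) (Kerr.exterior M₀ a) ∞)
    (hΦ : ContMDiff 𝓘(ℝ, E4) J (∞ + 1) Φ)
    (hΦ' : ∀ u, Function.Injective (mfderiv 𝓘(ℝ, E4) J Φ u))
    (hdim : Module.finrank ℝ E4 = Module.finrank ℝ F) (hsurj : Function.Surjective Φ)
    (T : ℝ → X → X)
    (hT : ∀ (s : ℝ) (x : Kerr.exterior M₀ a),
      Φ (Kerr.timeTranslate a (Kerr.rPlus M₀ a) s x) = T s (Φ x))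
    (Xs Xa : Π y : X, TangentSpace J y)
    (hXs : mpullback 𝓘(ℝ, E4) J Φ Xs = Kerr.stationaryField a (Kerr.rPlus M₀ a))
    (hXa : mpullback 𝓘(ℝ, E4) J Φ Xa = Kerr.axialField a (Kerr.rPlus M₀ a))
    (h0 : (g' 0).comap hpb Φ hΦ hΦ' hdim = Kerr.smoothMetric M₀ a (Kerr.rPlus M₀ a))
    (hparam : 0 < |a| ∧ |a| < M₀ ∧ 0 < ε ∧ 0 < μ) (hfield0 : Ψ' 0 = 0)
    (hsmooth : ∀ δ ∈ Ico 0 ε, ContMDiff J 𝓘(ℝ, ℂ) ∞ (Ψ' δ))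
    (hekg : ∀ δ ∈ Ico 0 ε, ∀ [(g' δ).HasLeviCivita],
      (g' δ).IsEinsteinKleinGordon (μ ^ 2) (Ψ' δ))
    (hkilling : ∀ δ ∈ Ico 0 ε, ∀ [(g' δ).HasLeviCivita],
      (g' δ).IsKillingField Xs ∧ (g' δ).IsKillingField Xa)
    (hperiodic : ∀ δ ∈ Ico 0 ε, ∃ ϖ : ℝ, ϖ ≠ 0 ∧ ∀ (s : ℝ) (y : X),
      Ψ' δ (T s y) = Complex.exp (-((ϖ * s : ℝ) : ℂ) * Complex.I) * Ψ' δ y)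
    (hnonzero : ∀ δ ∈ Ioo 0 ε, ∃ y, Ψ' δ y ≠ 0)
    (hmetric : ∀ (y : X) (V W : TangentSpace J y),
      DifferentiableWithinAt ℝ (fun δ ↦ (g' δ).val y V W) (Ici 0) 0)
    (hderiv : ∃ Ψhat' : X → ℂ, (∃ y, Ψhat' y ≠ 0) ∧ ContMDiff J 𝓘(ℝ, ℂ) ∞ Ψhat' ∧
      (∀ [(g' 0).HasLeviCivita],
        (∀ y, (g' 0).dalembertian (fun z ↦ (Ψhat' z).re) y = μ ^ 2 * (Ψhat' y).re) ∧
          ∀ y, (g' 0).dalembertian (fun z ↦ (Ψhat' z).im) y = μ ^ 2 * (Ψhat' y).im) ∧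
      (∃ ϖ : ℝ, ϖ ≠ 0 ∧ ∀ (s : ℝ) (y : X),
        Ψhat' (T s y) = Complex.exp (-((ϖ * s : ℝ) : ℂ) * Complex.I) * Ψhat' y) ∧
      ∀ y, HasDerivWithinAt (fun δ ↦ Ψ' δ y) (Ψhat' y) (Ici 0) 0) :
    IsHairyKerrFamily M₀ a ε μ (fun δ ↦ (g' δ).comap hpb Φ hΦ hΦ' hdim) (fun δ ↦ Ψ' δ ∘ Φ) where
  param := hparam
  metric_zero := h0
  field_zero := by
    funext x
    simp [hfield0]
  smooth δ hδ := (hsmooth δ hδ).comp (hΦ.of_le le_self_add)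
  ekg δ hδ := by
    intro inst
    have h2 : (2 : ℕ∞ω) ≤ ∞ := WithTop.coe_le_coe.mpr le_top
    haveI : (g' δ).HasLeviCivita := (g' δ).toPseudoRiemannianMetric.hasLeviCivita
    haveI : ((g' δ).toPseudoRiemannianMetric.comap hpb Φ hΦ hΦ' hdim).HasLeviCivita := inst
    exact PseudoRiemannianMetric.IsEinsteinKleinGordon.comap (g' δ).toPseudoRiemannianMetric hpb
      hΦ hΦ' hdim (hekg δ hδ) ((hsmooth δ hδ).of_le h2)
  killing δ hδ := by
    intro inst
    haveI : (g' δ).HasLeviCivita := (g' δ).toPseudoRiemannianMetric.hasLeviCivita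
    haveI : ((g' δ).toPseudoRiemannianMetric.comap hpb Φ hΦ hΦ' hdim).HasLeviCivita := inst
    obtain ⟨hs, ha⟩ := hkilling δ hδ
    have hs' := PseudoRiemannianMetric.IsKillingField.comap_mpullback
      (g' δ).toPseudoRiemannianMetric hpb hΦ hΦ' hdim hs
    have ha' := PseudoRiemannianMetric.IsKillingField.comap_mpullback
      (g' δ).toPseudoRiemannianMetric hpb hΦ hΦ' hdim ha
    rw [hXs] at hs'
    rw [hXa] at ha'
    exact ⟨hs', ha'⟩
  periodic δ hδ := by
    obtain ⟨ϖ, hϖ, hper⟩ := hperiodic δ hδ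
    exact ⟨ϖ, hϖ, fun s x ↦ by simp only [Function.comp_apply, hT, hper]⟩
  nonzero δ hδ := by
    obtain ⟨y, hy⟩ := hnonzero δ hδ
    obtain ⟨x, rfl⟩ := hsurj y
    exact ⟨x, hy⟩
  metric_differentiable x v w := by
    show DifferentiableWithinAt ℝ (fun δ ↦ (g' δ).val (Φ x) (mfderiv 𝓘(ℝ, E4) J Φ x v)
      (mfderiv 𝓘(ℝ, E4) J Φ x w)) (Ici 0) 0
    exact hmetric (Φ x) _ _
  field_hasDeriv := by
    obtain ⟨Ψhat', ⟨y, hy⟩, hsm, hkg, ⟨ϖ, hϖ, hper⟩, hder⟩ := hderiv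
    have h2 : (2 : ℕ∞ω) ≤ ∞ := WithTop.coe_le_coe.mpr le_top
    haveI i₁ : (g' 0).HasLeviCivita := (g' 0).toPseudoRiemannianMetric.hasLeviCivita
    haveI i₂ : ((g' 0).toPseudoRiemannianMetric.comap hpb Φ hΦ hΦ' hdim).HasLeviCivita :=
      PseudoRiemannianMetric.hasLeviCivita _
    haveI i₃ : ((g' 0).comap hpb Φ hΦ hΦ' hdim).HasLeviCivita := i₂
    -- equal metrics have equal wave operators (the Levi-Civita hypothesis is a `Prop`)
    -- (instances passed explicitly and the carrier spelled `Kerr.region a r₊` as in the type of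
    -- `Kerr.smoothMetric`, so that no instance has to be found across `Kerr.exterior = region`)
    have hcongr : ∀ {g₁ g₂ : LorentzianMetric 𝓘(ℝ, E4) ∞ (Kerr.region a (Kerr.rPlus M₀ a))}
        (i : g₁.HasLeviCivita) (j : g₂.HasLeviCivita), g₁ = g₂ →
        ∀ (f : Kerr.region a (Kerr.rPlus M₀ a) → ℝ) (x : Kerr.region a (Kerr.rPlus M₀ a)),
          (haveI := i; g₁.dalembertian f x) = (haveI := j; g₂.dalembertian f x) := by
      rintro g₁ g₂ i j rfl f x
      rfl
    have htrans := hcongr i₃ (Kerr.hasLeviCivita_smoothMetric M₀ a (Kerr.rPlus M₀ a)) h0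
    refine ⟨Ψhat' ∘ Φ, ?_, hsm.comp (hΦ.of_le le_self_add), fun x ↦ ?_, fun x ↦ ?_,
      ⟨ϖ, hϖ, fun s x ↦ by simp only [Function.comp_apply, hT, hper]⟩, fun x ↦ hder (Φ x)⟩
    · obtain ⟨x, rfl⟩ := hsurj y
      exact ⟨x, hy⟩
    · have hre : CMDiffAt 2 (fun z ↦ (Ψhat' z).re) (Φ x) :=
        contMDiff_re_of_contMDiff (hsm.of_le h2) (Φ x)
      have key := (g' 0).toPseudoRiemannianMetric.dalembertian_comap hpb hΦ hΦ' hdim hre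
      rw [hkg.1 (Φ x)] at key
      rw [← htrans]
      exact key
    · have him : CMDiffAt 2 (fun z ↦ (Ψhat' z).im) (Φ x) :=
        contMDiff_im_of_contMDiff (hsm.of_le h2) (Φ x)
      have key := (g' 0).toPseudoRiemannianMetric.dalembertian_comap hpb hΦ hΦ' hdim him
      rw [hkg.2 (Φ x)] at key
      rw [← htrans]
      exact key

end Transport

end Literature.Barriers.FinalStateConjecture

end
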